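import HarnessLib
import Summits.CriticalPhenomena.PercolationContinuityZ3.Cruxes.BudgetTightness.Disproof
import Summits.CriticalPhenomena.PercolationContinuityZ3.Theorems.PercBudgetLadderBudgetTightnessAspectTwo
import Summits.CriticalPhenomena.PercolationContinuityZ3.Theorems.PercBudgetLadderBudgetTightnessStubFeketeLimit

/-!
# Crux `BudgetTightness` (stmt-CriticalPhenomena-5248) — redirect strategist r1: PLACEMENT companion

Kernel-checked companions of `STRATEGY-CENSUS-r1.md` (planner-cstrat-stmt-CriticalPhenomena-5248-r1-0,
2026-08-17). Nothing here is new mathematics; the point is that every placement claim of the r1 census is a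
NAMED theorem of the tree, collected in one elaborating file.

§1 Placement of the crux BT between the route's target and Aizenman's open count problem (all re-exports):
   `X → BT` (Disproof §4), `BT → NonProliferation` (stmt-4444; AspectTwo), `BT ↔ slab core` (Dictionary),
   `¬(∀ d ≥ 3, TightAt d p_c 2)` granted the `η = 0` two-point input in `d = 7` (Disproof §5), and the split glue
   `NonProliferation → FewClustersCutTight → BT` (p168009, Theorems/PercBudgetLadderBudgetTightnessSplit.lean; not imported here). There is NO theorem `BT → PercolationContinuityZ3` or
   `PercolationContinuityZ3 → BT` in the tree, and none is expected (census §0).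
§2 (census S16) SUB-ANNULUS DOMINATION: a budget-`k` cut of ANY aspect-2 sub-annulus `A(m, 2m)` with
   `n ≤ m`, `2m ≤ l n` is a budget-`k` cut of `A(n, l n)`; hence `P(blocked_k(n, l n)) ≥ P(blocked_k(m, 2m))`.
   (The aspect-FREE weakening of BT/X that this feeds collapses to the conjunct; see the census.)
§3 (census N11) THE CUBE IS ON THE NECESSARY SIDE: `E_p[S(h, h)] ≤ τ_h(p) (h+1)²` for Kesten's slab flow constant
   `τ_h` (Fekete clause of `stub_feketeLimit` at `L = h`), so `liminf h² τ_h < ∞` (= BT) implies bounded mean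
   cube/torus-window throughput i.o., never conversely.
-/

noncomputable section

namespace Summit.CriticalPhenomena.PercolationContinuityZ3.Cruxes.BudgetTightness.PlacementR1

open MeasureTheory Filter Topology
open Literature.Probability.Percolation Literature.Probability.LatticeModels
open Summit.CriticalPhenomena.PercolationContinuityZ3.Theses.PercBudgetLadder
  (BudgetTightness CritAnnulusBlockedIO)
open Summit.CriticalPhenomena.PercolationContinuityZ3.Cruxes.BudgetTightness.Disproof
open Summit.CriticalPhenomena.PercolationContinuityZ3.Theorems.BudgetTightness

/-! ## §1 Placement (re-exports by name) -/

/-- The route's target `X = CritAnnulusBlockedIO` (stmt-5247) implies the crux. [folklore] -/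
theorem bt_of_target : CritAnnulusBlockedIO → BudgetTightness :=
  budgetTightness_of_critAnnulusBlockedIO

/-- The crux implies the crux `NonProliferation` of route `PercNonProliferation` (stmt-4444). [folklore] -/
theorem nonProliferation_of_bt :
    BudgetTightness →
      Summit.CriticalPhenomena.PercolationContinuityZ3.Theses.PercNonProliferation.NonProliferation :=
  nonProliferation_of_budgetTightness

/-- No `d`-uniform proof of the aspect-2 crux (granted the `η = 0` input in `d = 7`). [folklore] -/
theorem no_dim_uniform_proof (hτ : Literature.Barriers.CriticalPhenomena.TwoPointBoundedRatio 7) :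
    ¬ ∀ d : ℕ, 3 ≤ d → TightAt d (criticalProbI d) 2 :=
  not_forall_dim_tightAt_two hτ

/-! ## §2 Sub-annulus domination -/

/-- Shrinking the INNER box keeps a blocking cut: `blocked d k m M ⊆ blocked d k n M` for `n ≤ m`.
[folklore] -/
theorem blocked_anti_inner {d k n m M : ℕ} (hnm : n ≤ m) : blocked d k m M ⊆ blocked d k n M := by
  rintro ω ⟨S, hSk, hS⟩
  refine ⟨S, hSk, ?_⟩
  rintro ⟨x, hx, y, hy, hconn⟩
  exact hS ⟨x, box_mono d hnm hx, y, hy, hconn⟩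

/-- **Sub-annulus domination (pointwise, on the a.s. event `ω ⊆ E`)**: for `n ≤ m` and `2m ≤ M`, a
budget-`k` blocking of the aspect-2 sub-annulus `B(m) → ∂ⁱⁿB(2m)` is a budget-`k` blocking of
`B(n) → ∂ⁱⁿB(M)`. [folklore] -/
theorem blocked_of_subAnnulus {d k n m M : ℕ} (hnm : n ≤ m) (hmM : 2 * m ≤ M)
    {ω : BondConfig (Site d)} (hωE : ω ⊆ (zdGraph d).edgeSet) (hω : ω ∈ blocked d k m (2 * m)) :
    ω ∈ blocked d k n M :=
  blocked_anti_inner hnm (blocked_mono_aspect (by omega) hmM hωE hω)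

/-- **In probability**: `P_p(blocked_k(m, 2m)) ≤ P_p(blocked_k(n, M))` for `n ≤ m`, `2m ≤ M`; in particular
the budget-`k` blocking probability of `A(n, l n)` dominates that of EACH of its `⌊log₂ l⌋` disjoint dyadic
aspect-2 shells. [folklore] -/
theorem real_blocked_subAnnulus_le {d : ℕ} (p : unitInterval) (k : ℕ) {n m M : ℕ} (hnm : n ≤ m)
    (hmM : 2 * m ≤ M) :
    (bondPercolation (zdGraph d) p).real (blocked d k m (2 * m)) ≤
      (bondPercolation (zdGraph d) p).real (blocked d k n M) := by
  refine ENNReal.toReal_mono (measure_ne_top _ _) (measure_mono_ae ?_)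
  have hsub : ∀ᵐ ω ∂(bondPercolation (zdGraph d) p), ω ⊆ (zdGraph d).edgeSet :=
    ProbabilityTheory.setBernoulli_ae_subset
  filter_upwards [hsub] with ω hωE hω
  exact blocked_of_subAnnulus hnm hmM hωE hω

/-! ## §3 The cube is on the necessary side of the crux -/

/-- **`E_p[S(h, h)] ≤ τ_h(p) · (h+1)²`**: the mean bottom-to-top min-cut of the CUBE `[0,h]³` is at most
Kesten's slab flow constant times the area — the Fekete/superadditivity clause of `stub_feketeLimit` at
lateral size `L = h`. Consequently `liminf_h h² τ_h(p_c) < ∞` (⟺ BT, `budgetTightness_iff_slabCutQuadraticIO`)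
implies `liminf_h E[S(h,h)] < ∞`, and cube / torus-window statements are NECESSARY for BT, not sufficient.
[folklore] -/
theorem cube_mean_le_tau (p : unitInterval) (h : ℕ) (hh : 1 ≤ h) :
    ∃ τ : ℝ, 0 ≤ τ ∧ τ ≤ 1 ∧
      Filter.Tendsto (fun L : ℕ => (∫ ω, ((minOpenCutIn
          (Set.Icc (![0, 0, 0] : Site 3) ![(L : ℤ), (L : ℤ), (h : ℤ)])
          (Set.Icc (![0, 0, 0] : Site 3) ![(L : ℤ), (L : ℤ), 0])
          (Set.Icc (![0, 0, (h : ℤ)] : Site 3) ![(L : ℤ), (L : ℤ), (h : ℤ)])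
          ω).toNat : ℝ) ∂(bondPercolation (zdGraph 3) p)) / ((L : ℝ) + 1) ^ 2)
        Filter.atTop (nhds τ) ∧
      ∫ ω, ((minOpenCutIn
          (Set.Icc (![0, 0, 0] : Site 3) ![(h : ℤ), (h : ℤ), (h : ℤ)])
          (Set.Icc (![0, 0, 0] : Site 3) ![(h : ℤ), (h : ℤ), 0])
          (Set.Icc (![0, 0, (h : ℤ)] : Site 3) ![(h : ℤ), (h : ℤ), (h : ℤ)])
          ω).toNat : ℝ) ∂(bondPercolation (zdGraph 3) p) ≤ τ * ((h : ℝ) + 1) ^ 2 := by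
  obtain ⟨τ, h0, h1, hlim, hle⟩ := stub_feketeLimit p h hh
  exact ⟨τ, h0, h1, hlim, hle h⟩

end Summit.CriticalPhenomena.PercolationContinuityZ3.Cruxes.BudgetTightness.PlacementR1

end
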